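/-
Copyright (c) 2026 the pub-hodgecm-mathlib formalisation cell (harness21).  Prover seat hodgecm-mathlib-A-p17 (g20), floor 0, programme P5
(Alb-CM), in-house road for the letter L4if (ROAD CARD v4, A-p18 (g24)) — THE CLOSER: link (iv) assembled and the letter PROVED.  KERNEL module:
THEOREMS ONLY (no definition, no named fact, no `sorry`, no instance, no notation).
-/
import Summits.HodgeConjecture.HodgeConjecture.Theorems.F0P5LemD14IfNonsplitLetterOfCore
import Summits.HodgeConjecture.HodgeConjecture.Theorems.F0P5LemD14IfGaloisSimilitudeTheta
import Summits.HodgeConjecture.HodgeConjecture.Theorems.F0P5LemD14IfTwistedTransportGlue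
import Summits.HodgeConjecture.HodgeConjecture.Theorems.F0P5CurveThetaCompanionGalConjCoinvariants
import Summits.HodgeConjecture.HodgeConjecture.Theorems.F0P5CurveThetaCompanionDetScalarDictionary
import Literature.NumberTheory.GelbartRogawski1991.LocalGaloisConjCoinvariants
import Literature.NumberTheory.GelbartRogawski1991.LocalSplittingCMGaloisTransport
import HarnessLib

/-!
# F0 · P5 pay-down line `Cruxes/HLiu418/Lines/F0_P5_CurveThetaLettersPaydown` (ED. 7), letter L4if — PROVED: `LemD1_4IfAsPrintedNonsplitCM₂` holds

Cell `hodgecm-mathlib`, floor 0, programme P5 (Alb-CM); crux item `stmt-HodgeConjecture-24832`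
(`Summit.HodgeConjecture.HodgeConjecture.Theses.HCCMUnconditional.HLiu418`).  THE CLOSER of the in-house road for the last local letter of #74
(road cards `F0/P5/A-p18/g23/ROAD-L4if-v3.A-p18g23.md`, `F0/P5/A-p18/g24/ROAD-L4if-v4.A-p18g24.md`; 30+ ★ files by A-p18 (g23/g24), A-p12 (g18),
B-p04 (g32) and A-p17 (g19/g20)):

* §1 **`core_link_iv`** — link (iv) of ROAD v4 §2 at the enumeration `Equiv.prodUnique (Fin 2) (Fin 1)`, in the ∃-form consumed by ★ (P2)
  `lemD1_4IfAsPrintedNonsplitCM₂_of_core`: for every datum of the letter, `∃ b u, b = −t₀t₁·a·u² ∧ Θ_{pU}(Λ′, b; ξ_b) ≅ Θ_{pU}(Λ, a; ξ_a)`, at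
  `b := −a₀`, `a₀ := (a·t₀t₁)⁻¹`, `u := a₀` (`tᵢ = dVᵢ ∈ L⁺`).  It is ★ (P1) `areIsomorphicRep_of_twisted_transports` applied to
  `hT :=` ★ step 3 `exists_coinv_equiv_companion_galConj` (A-p17 (g20); `Θ_{ξ_b}(Λ′, b) → Θ_{ξ_b∘bar₁}(Λᶜ, b)`, multiplier `α₀((det k)_v)` with
  `α₀(u) = χ(u_f)`, `hξ` by ★ `localPiGalConj_eq_inv_rankOne`) and `hE :=` ★ (C4bΘ) `exists_coinv_equiv_galConj_similitude_theta` (A-p18 (g24);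
  `Θ_{ξ_b∘bar₁}(Λᶜ, b) → Θ_{ξ_a}(Λ, a)`, multiplier `ξ_b(localUnitScalar (det (k ⊗ 1))⁻¹)`, at the letter's packages through ★
  `congrW_undoubledSplittings_cmFinLocalFamily_s`, `det T_{a₀} = t₀t₁a₀²` by ★ `gram_diagonal_TW`, `T_a = (det T_{a₀})⁻¹ • T_{a₀}` by ★
  `gram_TW_eq_smul`), the two multipliers cancelling by ★ (D8) `det_localPiEquiv_localLineInl`, ★ `localUnitScalar_congr` and ★ (D7)
  `apply_finitePart_adelicDet_inclPlace_mul_localCharOfCenter_inv`.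
* §2 **`lemD1_4IfAsPrintedNonsplitCM₂_holds : LemD1RankTwoCMLetters.LemD1_4IfAsPrintedNonsplitCM₂`** — [Liu2021, App. D, Lem. D.1 (4)] «if»
  direction, second alternative, for the two CM θ-package members `(λ, a, χ)`, `(λᶜχ̌, a′, χ)` at the NON-SPLIT finite places (the P5 ED. 7 stub
  `stub_letter_lemD14_if_nonsplit`, in print the rank-one theta dichotomy [HarrisKudlaSweet1996, Thm. 6.1]) — PROVED: ★ (P2) at §1.  The Lines
  file's one-liner `stub_letter_lemD14_if_nonsplit := F0P5LemD14IfNonsplitLetter.lemD1_4IfAsPrintedNonsplitCM₂_holds` is the desk's edition.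

HONEST LABEL: HC_CM is proved only modulo the printed citations — the 2 remaining named inputs (hLiu418, h413) — until rung 0 closes; this
file proves ONE registered letter stub (L4if) of ONE floor-0 pay-down line of hLiu418 (`--supports`, no statement item closed here; #74's
other leaf G2 and #73's G1 remain typer-first), and touches no book.

## References
* [Liu2021] Y. Liu, *Fourier–Jacobi cycles and arithmetic relative trace formula*, Camb. J. Math. 9 (2021) = arXiv:2102.11518: App. D §D.1
  Steps 1–3 (l. 5213–5224), Lem. D.1 (4) (p. 126, l. 5235), proof l. 5240–5262.
* [HarrisKudlaSweet1996] M. Harris, S. Kudla, W. J. Sweet, *Theta dichotomy for unitary groups*, J. AMS 9 (1996), Thm. 6.1.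
* [GelbartRogawski1991] S. Gelbart, J. Rogawski, Invent. Math. 105 (1991), §3.1 Prop. 3.1.1 p. 455, Remark p. 457 L4–13.
* [MoeglinVignerasWaldspurger1987] LNM 1291 (1987), Chap. 2 II.1–II.2, Chap. 3 I.1–I.3, IV.
-/

set_option autoImplicit false
set_option linter.dupNamespace false

noncomputable section

open NumberField IsDedekindDomain Matrix MeasureTheory
open scoped MatrixGroups Kronecker
open Literature.NumberTheory.Automorphic Literature.NumberTheory.Automorphic.UnitaryGroup
open Literature.NumberTheory.GelbartRogawski1991 Literature.NumberTheory.GelbartRogawski1991.UnitaryDualPair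
open Literature.NumberTheory.GelbartRogawski1991.UnitaryDualPair.LocalSplitting Literature.NumberTheory.GelbartRogawski1991.UnitaryDualPair.WeilCoinv
open Literature.NumberTheory.GelbartRogawski1991.GRConstruction
open Literature.NumberTheory.Automorphic.IdeleClassGroup
open Literature.NumberTheory.Automorphic.Liu2021 Literature.NumberTheory.Automorphic.Liu2021.Def411WeilCarriers
open Literature.NumberTheory.Automorphic.Liu2021.Def411WeilCarriersDoubling
open Literature.NumberTheory.Automorphic.Liu2021.LemD1RankTwoCMLetters
open Literature.RepresentationTheory Literature.RepresentationTheory.HeisenbergGroup Literature.RepresentationTheory.Liu2021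
open Literature.NumberTheory.GaloisRepresentations Literature.RepresentationTheory.HarrisKudlaSweet1996
open Summit.HodgeConjecture.HodgeConjecture.Cruxes.HLiu418.F0P5CurveThetaCompanionDetTwist
open Summit.HodgeConjecture.HodgeConjecture.Cruxes.HLiu418.F0P5LemD14IfGaloisSimilitudeTheta
open Summit.HodgeConjecture.HodgeConjecture.Cruxes.HLiu418.F0P5LemD14IfTwistedTransportGlue
open Summit.HodgeConjecture.HodgeConjecture.Cruxes.HLiu418.F0P5LemD14IfNonsplitLetterOfCore

namespace Summit.HodgeConjecture.HodgeConjecture.Cruxes.HLiu418.F0P5LemD14IfNonsplitLetter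

/-! ## §1 The core link (iv): `Θ_{pU}(Λ′, −a₀) ≅ Θ_{pU}(Λ, a)`, `a₀ = (a·t₀t₁)⁻¹` -/

section Core

variable (L : Type) [Field L] [NumberField L] [IsCMField L]
  (dV : Fin 2 → L) (hdV : ∀ i, IsCMField.complexConj L (dV i) = dV i) (hdV0 : ∀ i, dV i ≠ 0)
  (lam : Literature.NumberTheory.Automorphic.IdeleClassGroup L →ₜ* Circle) (hlam : IsConjugateSymplectic L lam)
  (χ : Chi (Fp L) L (IsCMField.complexConj L))
  (lam' : Literature.NumberTheory.Automorphic.IdeleClassGroup L →ₜ* Circle) (hlam' : IsConjugateSymplectic L lam')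
  (hcc : IsCMField.complexConj L * IsCMField.complexConj L = 1)
  (hH : toHeckeCharacter L lam' =
    toHeckeCharacter L (IdeleClassGroup.galConj (IsCMField.complexConj L) lam) * HeckeCharacter.checkOfChi hcc χ)
  (a : (Fp L)ˣ) (v : HeightOneSpectrum (𝓞 (Fp L)))
  (hns : ∀ w : UnitaryGroup.PlacesOver L v, IsCMField.complexConj L • (w : HeightOneSpectrum (𝓞 L)) = w)

include hdV0 in
/-- the real frame entries `tᵢ = dVᵢ ∈ L⁺` are non-zero. [cite: Liu2021, App. D §D.1 Step 1 (l. 5217)] -/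
theorem realEntry_ne_zero (i : Fin 2) : ((⟨dV i, (IsCMField.complexConj_eq_self_iff (K := L) (dV i)).1 (hdV i)⟩ : Fp L)) ≠ 0 := fun h =>
  hdV0 i (congrArg Subtype.val h)

include hH hns in
set_option synthInstance.maxHeartbeats 400000 in
set_option maxHeartbeats 24000000 in
/-- **LINK (iv) OF ROAD v4 §2 — THE CORE: `∃ b u, b = −t₀t₁·a·u² ∧ Θ_{pU}(Λ′, b; ξ_b) ≅ Θ_{pU}(Λ, a; ξ_a)`** at `b := −a₀`, `a₀ := (a·t₀t₁)⁻¹`, `u := a₀`: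
★ step 3 `exists_coinv_equiv_companion_galConj` (`Θ_{ξ_b}(Λ′, b) → Θ_{ξ_b∘bar₁}(Λᶜ, b)`, multiplier `α₀((det k)_v)`, `α₀(u) = χ(u_f)`) ∘ ★ (C4bΘ)
`exists_coinv_equiv_galConj_similitude_theta` (`Θ_{ξ_b∘bar₁}(Λᶜ, b) → Θ_{ξ_a}(Λ, a)`, multiplier `ξ_b(localUnitScalar (det (k ⊗ 1))⁻¹)`), whose multipliers cancel
by ★ (D8) `det_localPiEquiv_localLineInl`, ★ `localUnitScalar_congr` and ★ (D7) `apply_finitePart_adelicDet_inclPlace_mul_localCharOfCenter_inv`; glued by ★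
`areIsomorphicRep_of_twisted_transports`.  The (C4bΘ) inputs: `h𝓣′`, `h𝓣` := ★ `congrW_undoubledSplittings_cmFinLocalFamily_s`; `hTd`, `ha` from ★ `gram_diagonal_TW`,
★ `gram_TW_eq_smul` (`det T_{a₀} = t₀t₁a₀²`, `(det T_{a₀})⁻¹ = a·a₀⁻¹`). [cite: Liu2021, App. D Lemma D.1 (4) (p. 126, l. 5235), §D.1 Step 3 (l. 5221)]
[cite: GelbartRogawski1991, §3.1 Remark p. 457 L4–13] [cite: HarrisKudlaSweet1996, Thm. 6.1] -/
theorem core_link_iv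
    (ht : ∀ i : Fin 2, ((⟨dV i, (IsCMField.complexConj_eq_self_iff (K := L) (dV i)).1 (hdV i)⟩ : Fp L)) ≠ 0) :
    ∃ b u : (Fp L)ˣ, (b : Fp L) = -((⟨dV 0, (IsCMField.complexConj_eq_self_iff (K := L) (dV 0)).1 (hdV 0)⟩ : Fp L) * (⟨dV 1, (IsCMField.complexConj_eq_self_iff (K := L) (dV 1)).1 (hdV 1)⟩ : Fp L)) * a * (u : Fp L) ^ 2 ∧
      AreIsomorphicRep
      (show Representation ℂ (UnitaryGroup.localPi L (IsCMField.complexConj L) 2 (Matrix.diagonal dV) v) _ from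
        (TwistedCoinv.rep (localCharOfCenter (Fp L) L (IsCMField.complexConj L) (JW (Fp L) L b) (JW_apply_ne_zero (Fp L) L b) χ.1 v)
          ((congrW L (Equiv.prodUnique (Fin 2) (Fin 1)) dV hdV (lineW L (TW (Fp L) b)) (complexConj_lineW L (TW (Fp L) b))
            (realDiagonal_lineW L (TW (Fp L) b)) (diagonal_lineW L (TW (Fp L) b) (JW_eq (Fp L) L b))
            (undoubledSplittings L (Equiv.prodUnique (Fin 2) (Fin 1)) dV hdV hdV0 (lineW L (TW (Fp L) b)) (complexConj_lineW L (TW (Fp L) b))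
              (lineW_ne_zero L (TW (Fp L) b) (isUnit_det_TW (Fp L) b)) (toHeckeCharacter L lam') (borelPlaceMeasure L)
              (cmFinLocalFamily L (Equiv.prodUnique (Fin 2) (Fin 1)) dV hdV hdV0 (lineW L (TW (Fp L) b)) (complexConj_lineW L (TW (Fp L) b))
                (lineW_ne_zero L (TW (Fp L) b) (isUnit_det_TW (Fp L) b)) (toHeckeCharacter L lam') ((isOscillatorChar_toHeckeCharacter_iff lam').mpr hlam') (borelPlaceMeasure L)))
            (isSymm_TW (Fp L) b) (JW_eq (Fp L) L b)).omegaLoc v)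
          (commute_omegaLoc_localCenter (Fp L) L (IsCMField.complexConj L) 2 (Equiv.prodUnique (Fin 2) (Fin 1)) (Matrix.diagonal dV) (JW (Fp L) L b)
            (complexConj_imagUnit L) (imagUnit_ne_zero L) (imagUnit_mul_self L) (realDiagonal_isSymm L dV hdV) (isSymm_TW (Fp L) b)
            (realDiagonal_map L dV hdV).symm (JW_eq (Fp L) L b) (JW_apply_ne_zero (Fp L) L b)
            (congrW L (Equiv.prodUnique (Fin 2) (Fin 1)) dV hdV (lineW L (TW (Fp L) b)) (complexConj_lineW L (TW (Fp L) b))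
            (realDiagonal_lineW L (TW (Fp L) b)) (diagonal_lineW L (TW (Fp L) b) (JW_eq (Fp L) L b))
            (undoubledSplittings L (Equiv.prodUnique (Fin 2) (Fin 1)) dV hdV hdV0 (lineW L (TW (Fp L) b)) (complexConj_lineW L (TW (Fp L) b))
              (lineW_ne_zero L (TW (Fp L) b) (isUnit_det_TW (Fp L) b)) (toHeckeCharacter L lam') (borelPlaceMeasure L)
              (cmFinLocalFamily L (Equiv.prodUnique (Fin 2) (Fin 1)) dV hdV hdV0 (lineW L (TW (Fp L) b)) (complexConj_lineW L (TW (Fp L) b))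
                (lineW_ne_zero L (TW (Fp L) b) (isUnit_det_TW (Fp L) b)) (toHeckeCharacter L lam') ((isOscillatorChar_toHeckeCharacter_iff lam').mpr hlam') (borelPlaceMeasure L)))
            (isSymm_TW (Fp L) b) (JW_eq (Fp L) L b)) v)).comp
          (UnitaryGroup.localLineInl L (IsCMField.complexConj L) 2 (Equiv.prodUnique (Fin 2) (Fin 1)) (Matrix.diagonal dV) (JW (Fp L) L b) v))
      (show Representation ℂ (UnitaryGroup.localPi L (IsCMField.complexConj L) 2 (Matrix.diagonal dV) v) _ from
        (TwistedCoinv.rep (localCharOfCenter (Fp L) L (IsCMField.complexConj L) (JW (Fp L) L a) (JW_apply_ne_zero (Fp L) L a) χ.1 v)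
          ((congrW L (Equiv.prodUnique (Fin 2) (Fin 1)) dV hdV (lineW L (TW (Fp L) a)) (complexConj_lineW L (TW (Fp L) a))
            (realDiagonal_lineW L (TW (Fp L) a)) (diagonal_lineW L (TW (Fp L) a) (JW_eq (Fp L) L a))
            (undoubledSplittings L (Equiv.prodUnique (Fin 2) (Fin 1)) dV hdV hdV0 (lineW L (TW (Fp L) a)) (complexConj_lineW L (TW (Fp L) a))
              (lineW_ne_zero L (TW (Fp L) a) (isUnit_det_TW (Fp L) a)) (toHeckeCharacter L lam) (borelPlaceMeasure L)
              (cmFinLocalFamily L (Equiv.prodUnique (Fin 2) (Fin 1)) dV hdV hdV0 (lineW L (TW (Fp L) a)) (complexConj_lineW L (TW (Fp L) a))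
                (lineW_ne_zero L (TW (Fp L) a) (isUnit_det_TW (Fp L) a)) (toHeckeCharacter L lam) ((isOscillatorChar_toHeckeCharacter_iff lam).mpr hlam) (borelPlaceMeasure L)))
            (isSymm_TW (Fp L) a) (JW_eq (Fp L) L a)).omegaLoc v)
          (commute_omegaLoc_localCenter (Fp L) L (IsCMField.complexConj L) 2 (Equiv.prodUnique (Fin 2) (Fin 1)) (Matrix.diagonal dV) (JW (Fp L) L a)
            (complexConj_imagUnit L) (imagUnit_ne_zero L) (imagUnit_mul_self L) (realDiagonal_isSymm L dV hdV) (isSymm_TW (Fp L) a)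
            (realDiagonal_map L dV hdV).symm (JW_eq (Fp L) L a) (JW_apply_ne_zero (Fp L) L a)
            (congrW L (Equiv.prodUnique (Fin 2) (Fin 1)) dV hdV (lineW L (TW (Fp L) a)) (complexConj_lineW L (TW (Fp L) a))
            (realDiagonal_lineW L (TW (Fp L) a)) (diagonal_lineW L (TW (Fp L) a) (JW_eq (Fp L) L a))
            (undoubledSplittings L (Equiv.prodUnique (Fin 2) (Fin 1)) dV hdV hdV0 (lineW L (TW (Fp L) a)) (complexConj_lineW L (TW (Fp L) a))
              (lineW_ne_zero L (TW (Fp L) a) (isUnit_det_TW (Fp L) a)) (toHeckeCharacter L lam) (borelPlaceMeasure L)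
              (cmFinLocalFamily L (Equiv.prodUnique (Fin 2) (Fin 1)) dV hdV hdV0 (lineW L (TW (Fp L) a)) (complexConj_lineW L (TW (Fp L) a))
                (lineW_ne_zero L (TW (Fp L) a) (isUnit_det_TW (Fp L) a)) (toHeckeCharacter L lam) ((isOscillatorChar_toHeckeCharacter_iff lam).mpr hlam) (borelPlaceMeasure L)))
            (isSymm_TW (Fp L) a) (JW_eq (Fp L) L a)) v)).comp
          (UnitaryGroup.localLineInl L (IsCMField.complexConj L) 2 (Equiv.prodUnique (Fin 2) (Fin 1)) (Matrix.diagonal dV) (JW (Fp L) L a) v)) := by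
  refine ⟨(-(a * (Units.mk0 ((⟨dV 0, (IsCMField.complexConj_eq_self_iff (K := L) (dV 0)).1 (hdV 0)⟩ : Fp L) * (⟨dV 1, (IsCMField.complexConj_eq_self_iff (K := L) (dV 1)).1 (hdV 1)⟩ : Fp L)) (mul_ne_zero (ht 0) (ht 1))))⁻¹), (a * (Units.mk0 ((⟨dV 0, (IsCMField.complexConj_eq_self_iff (K := L) (dV 0)).1 (hdV 0)⟩ : Fp L) * (⟨dV 1, (IsCMField.complexConj_eq_self_iff (K := L) (dV 1)).1 (hdV 1)⟩ : Fp L)) (mul_ne_zero (ht 0) (ht 1))))⁻¹, ?_, ?_⟩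
  · -- `−a₀ = −t₀t₁ · a · a₀²` in `L⁺`
    have ha0 : (a : Fp L) ≠ 0 := a.ne_zero
    rw [Units.val_neg, Units.val_inv_eq_inv_val, Units.val_mul, Units.val_mk0]
    field_simp
  -- the data of the two transports
  have hJdet : (Matrix.diagonal dV).det ≠ 0 :=
    det_JV_ne_zero (Fp L) L 2 (Matrix.diagonal dV) (isUnit_det_realDiagonal L dV hdV hdV0) (realDiagonal_map L dV hdV).symm
  obtain ⟨α₀, hα₀⟩ := exists_alphaChi L χ
  -- (C4bΘ)'s Gram inputs: `det T_{a₀} ≠ 0` and `T_a = (det T_{a₀})⁻¹ • T_{a₀}`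
  have hdet : (gram (Fp L) (Equiv.prodUnique (Fin 2) (Fin 1)) (realDiagonal L dV hdV) (TW (Fp L) (a * (Units.mk0 ((⟨dV 0, (IsCMField.complexConj_eq_self_iff (K := L) (dV 0)).1 (hdV 0)⟩ : Fp L) * (⟨dV 1, (IsCMField.complexConj_eq_self_iff (K := L) (dV 1)).1 (hdV 1)⟩ : Fp L)) (mul_ne_zero (ht 0) (ht 1))))⁻¹)).det =
      (⟨dV 0, (IsCMField.complexConj_eq_self_iff (K := L) (dV 0)).1 (hdV 0)⟩ : Fp L) * (⟨dV 1, (IsCMField.complexConj_eq_self_iff (K := L) (dV 1)).1 (hdV 1)⟩ : Fp L) * (((a * (Units.mk0 ((⟨dV 0, (IsCMField.complexConj_eq_self_iff (K := L) (dV 0)).1 (hdV 0)⟩ : Fp L) * (⟨dV 1, (IsCMField.complexConj_eq_self_iff (K := L) (dV 1)).1 (hdV 1)⟩ : Fp L)) (mul_ne_zero (ht 0) (ht 1))))⁻¹ : (Fp L)ˣ) : Fp L) ^ 2 := by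
    rw [show gram (Fp L) (Equiv.prodUnique (Fin 2) (Fin 1)) (realDiagonal L dV hdV) (TW (Fp L) (a * (Units.mk0 ((⟨dV 0, (IsCMField.complexConj_eq_self_iff (K := L) (dV 0)).1 (hdV 0)⟩ : Fp L) * (⟨dV 1, (IsCMField.complexConj_eq_self_iff (K := L) (dV 1)).1 (hdV 1)⟩ : Fp L)) (mul_ne_zero (ht 0) (ht 1))))⁻¹) = _ from
      gram_diagonal_TW (Equiv.prodUnique (Fin 2) (Fin 1)) (fun i => (⟨dV i, (IsCMField.complexConj_eq_self_iff (K := L) (dV i)).1 (hdV i)⟩ : Fp L)) (a * (Units.mk0 ((⟨dV 0, (IsCMField.complexConj_eq_self_iff (K := L) (dV 0)).1 (hdV 0)⟩ : Fp L) * (⟨dV 1, (IsCMField.complexConj_eq_self_iff (K := L) (dV 1)).1 (hdV 1)⟩ : Fp L)) (mul_ne_zero (ht 0) (ht 1))))⁻¹, Matrix.det_diagonal, Fin.prod_univ_two]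
    simp only [Equiv.prodUnique_symm_apply]
    ring
  have hTd : (gram (Fp L) (Equiv.prodUnique (Fin 2) (Fin 1)) (realDiagonal L dV hdV) (TW (Fp L) (a * (Units.mk0 ((⟨dV 0, (IsCMField.complexConj_eq_self_iff (K := L) (dV 0)).1 (hdV 0)⟩ : Fp L) * (⟨dV 1, (IsCMField.complexConj_eq_self_iff (K := L) (dV 1)).1 (hdV 1)⟩ : Fp L)) (mul_ne_zero (ht 0) (ht 1))))⁻¹)).det ≠ 0 :=
    (isUnit_det_gram (Fp L) (Equiv.prodUnique (Fin 2) (Fin 1)) (isUnit_det_realDiagonal L dV hdV hdV0) (isUnit_det_TW (Fp L) (a * (Units.mk0 ((⟨dV 0, (IsCMField.complexConj_eq_self_iff (K := L) (dV 0)).1 (hdV 0)⟩ : Fp L) * (⟨dV 1, (IsCMField.complexConj_eq_self_iff (K := L) (dV 1)).1 (hdV 1)⟩ : Fp L)) (mul_ne_zero (ht 0) (ht 1))))⁻¹)).ne_zero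
  have ha : gram (Fp L) (Equiv.prodUnique (Fin 2) (Fin 1)) (realDiagonal L dV hdV) (TW (Fp L) a) =
      (((Units.mk0 _ hTd)⁻¹ : (Fp L)ˣ) : Fp L) • gram (Fp L) (Equiv.prodUnique (Fin 2) (Fin 1)) (realDiagonal L dV hdV) (TW (Fp L) (a * (Units.mk0 ((⟨dV 0, (IsCMField.complexConj_eq_self_iff (K := L) (dV 0)).1 (hdV 0)⟩ : Fp L) * (⟨dV 1, (IsCMField.complexConj_eq_self_iff (K := L) (dV 1)).1 (hdV 1)⟩ : Fp L)) (mul_ne_zero (ht 0) (ht 1))))⁻¹) := by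
    rw [gram_TW_eq_smul L (Equiv.prodUnique (Fin 2) (Fin 1)) dV hdV (a * (Units.mk0 ((⟨dV 0, (IsCMField.complexConj_eq_self_iff (K := L) (dV 0)).1 (hdV 0)⟩ : Fp L) * (⟨dV 1, (IsCMField.complexConj_eq_self_iff (K := L) (dV 1)).1 (hdV 1)⟩ : Fp L)) (mul_ne_zero (ht 0) (ht 1))))⁻¹ a]
    congr 1
    have ha0 : (a : Fp L) ≠ 0 := a.ne_zero
    have hD0 : (⟨dV 0, (IsCMField.complexConj_eq_self_iff (K := L) (dV 0)).1 (hdV 0)⟩ : Fp L) * (⟨dV 1, (IsCMField.complexConj_eq_self_iff (K := L) (dV 1)).1 (hdV 1)⟩ : Fp L) ≠ 0 := mul_ne_zero (ht 0) (ht 1)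
    have h0 := ht 0
    have h1 := ht 1
    simp only [Units.val_mul, Units.val_inv_eq_inv_val, Units.val_mk0, hdet]
    field_simp
  -- hT: ★ step 3 at the line `b = −a₀`, `ξ′ := ξ_b`, `ξ := ξ_b ∘ bar₁` (`hξ` by ★ `localPiGalConj_eq_inv_rankOne`)
  have hT := exists_coinv_equiv_companion_galConj L dV hdV hdV0 hJdet hcc (Equiv.prodUnique (Fin 2) (Fin 1)) lam hlam χ lam' hlam' hH α₀ hα₀ (-(a * (Units.mk0 ((⟨dV 0, (IsCMField.complexConj_eq_self_iff (K := L) (dV 0)).1 (hdV 0)⟩ : Fp L) * (⟨dV 1, (IsCMField.complexConj_eq_self_iff (K := L) (dV 1)).1 (hdV 1)⟩ : Fp L)) (mul_ne_zero (ht 0) (ht 1))))⁻¹) v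
    ((localCharOfCenter (Fp L) L (IsCMField.complexConj L) (JW (Fp L) L (-(a * (Units.mk0 ((⟨dV 0, (IsCMField.complexConj_eq_self_iff (K := L) (dV 0)).1 (hdV 0)⟩ : Fp L) * (⟨dV 1, (IsCMField.complexConj_eq_self_iff (K := L) (dV 1)).1 (hdV 1)⟩ : Fp L)) (mul_ne_zero (ht 0) (ht 1))))⁻¹)) (JW_apply_ne_zero (Fp L) L (-(a * (Units.mk0 ((⟨dV 0, (IsCMField.complexConj_eq_self_iff (K := L) (dV 0)).1 (hdV 0)⟩ : Fp L) * (⟨dV 1, (IsCMField.complexConj_eq_self_iff (K := L) (dV 1)).1 (hdV 1)⟩ : Fp L)) (mul_ne_zero (ht 0) (ht 1))))⁻¹)) χ.1 v).comp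
          (localPiGalConj L (IsCMField.complexConj L) 1 v (JW_eq (Fp L) L (-(a * (Units.mk0 ((⟨dV 0, (IsCMField.complexConj_eq_self_iff (K := L) (dV 0)).1 (hdV 0)⟩ : Fp L) * (⟨dV 1, (IsCMField.complexConj_eq_self_iff (K := L) (dV 1)).1 (hdV 1)⟩ : Fp L)) (mul_ne_zero (ht 0) (ht 1))))⁻¹))))
    (localCharOfCenter (Fp L) L (IsCMField.complexConj L) (JW (Fp L) L (-(a * (Units.mk0 ((⟨dV 0, (IsCMField.complexConj_eq_self_iff (K := L) (dV 0)).1 (hdV 0)⟩ : Fp L) * (⟨dV 1, (IsCMField.complexConj_eq_self_iff (K := L) (dV 1)).1 (hdV 1)⟩ : Fp L)) (mul_ne_zero (ht 0) (ht 1))))⁻¹)) (JW_apply_ne_zero (Fp L) L (-(a * (Units.mk0 ((⟨dV 0, (IsCMField.complexConj_eq_self_iff (K := L) (dV 0)).1 (hdV 0)⟩ : Fp L) * (⟨dV 1, (IsCMField.complexConj_eq_self_iff (K := L) (dV 1)).1 (hdV 1)⟩ : Fp L)) (mul_ne_zero (ht 0) (ht 1))))⁻¹)) χ.1 v)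
    (fun z => by
      rw [MonoidHom.comp_apply, localPiGalConj_eq_inv_rankOne L (IsCMField.complexConj L) v (isUnit_det_TW (Fp L) (-(a * (Units.mk0 ((⟨dV 0, (IsCMField.complexConj_eq_self_iff (K := L) (dV 0)).1 (hdV 0)⟩ : Fp L) * (⟨dV 1, (IsCMField.complexConj_eq_self_iff (K := L) (dV 1)).1 (hdV 1)⟩ : Fp L)) (mul_ne_zero (ht 0) (ht 1))))⁻¹))
        (JW_eq (Fp L) L (-(a * (Units.mk0 ((⟨dV 0, (IsCMField.complexConj_eq_self_iff (K := L) (dV 0)).1 (hdV 0)⟩ : Fp L) * (⟨dV 1, (IsCMField.complexConj_eq_self_iff (K := L) (dV 1)).1 (hdV 1)⟩ : Fp L)) (mul_ne_zero (ht 0) (ht 1))))⁻¹)), map_inv, pow_two, mul_inv_cancel_right])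
  -- hE: ★ (C4bΘ) at the letter's packages of `Λᶜ` (line `−a₀`) and `Λ` (line `a`)
  have hE := exists_coinv_equiv_galConj_similitude_theta L dV hdV hdV0 (Equiv.prodUnique (Fin 2) (Fin 1)) lam hlam χ.1 (a * (Units.mk0 ((⟨dV 0, (IsCMField.complexConj_eq_self_iff (K := L) (dV 0)).1 (hdV 0)⟩ : Fp L) * (⟨dV 1, (IsCMField.complexConj_eq_self_iff (K := L) (dV 1)).1 (hdV 1)⟩ : Fp L)) (mul_ne_zero (ht 0) (ht 1))))⁻¹ a v hns hTd ha
    (congrW L (Equiv.prodUnique (Fin 2) (Fin 1)) dV hdV (lineW L (TW (Fp L) (-(a * (Units.mk0 ((⟨dV 0, (IsCMField.complexConj_eq_self_iff (K := L) (dV 0)).1 (hdV 0)⟩ : Fp L) * (⟨dV 1, (IsCMField.complexConj_eq_self_iff (K := L) (dV 1)).1 (hdV 1)⟩ : Fp L)) (mul_ne_zero (ht 0) (ht 1))))⁻¹))) (complexConj_lineW L (TW (Fp L) (-(a * (Units.mk0 ((⟨dV 0, (IsCMField.complexConj_eq_self_iff (K := L) (dV 0)).1 (hdV 0)⟩ :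 Fp L) * (⟨dV 1, (IsCMField.complexConj_eq_self_iff (K := L) (dV 1)).1 (hdV 1)⟩ : Fp L)) (mul_ne_zero (ht 0) (ht 1))))⁻¹)))
            (realDiagonal_lineW L (TW (Fp L) (-(a * (Units.mk0 ((⟨dV 0, (IsCMField.complexConj_eq_self_iff (K := L) (dV 0)).1 (hdV 0)⟩ : Fp L) * (⟨dV 1, (IsCMField.complexConj_eq_self_iff (K := L) (dV 1)).1 (hdV 1)⟩ : Fp L)) (mul_ne_zero (ht 0) (ht 1))))⁻¹))) (diagonal_lineW L (TW (Fp L) (-(a * (Units.mk0 ((⟨dV 0, (IsCMField.complexConj_eq_self_iff (K := L) (dV 0)).1 (hdV 0)⟩ : Fp L) * (⟨dV 1, (IsCMField.complexConj_eq_self_iff (K := L) (dV 1)).1 (hdV 1)⟩ : Fp L)) (mul_ne_zero (ht 0) (ht 1))))⁻¹)) (JW_eq (Fp L) L (-(a * (Units.mk0 ((⟨dV 0, (IsCMField.complexConj_eq_self_iff (K := L) (dV 0)).1 (hdV 0)⟩ : Fp L) * (⟨dV 1, (IsCMField.complexConj_eq_self_iff (K := L) (dV 1)).1 (hdV 1)⟩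 : Fp L)) (mul_ne_zero (ht 0) (ht 1))))⁻¹)))
            (undoubledSplittings L (Equiv.prodUnique (Fin 2) (Fin 1)) dV hdV hdV0 (lineW L (TW (Fp L) (-(a * (Units.mk0 ((⟨dV 0, (IsCMField.complexConj_eq_self_iff (K := L) (dV 0)).1 (hdV 0)⟩ : Fp L) * (⟨dV 1, (IsCMField.complexConj_eq_self_iff (K := L) (dV 1)).1 (hdV 1)⟩ : Fp L)) (mul_ne_zero (ht 0) (ht 1))))⁻¹))) (complexConj_lineW L (TW (Fp L) (-(a * (Units.mk0 ((⟨dV 0, (IsCMField.complexConj_eq_self_iff (K := L) (dV 0)).1 (hdV 0)⟩ : Fp L) * (⟨dV 1, (IsCMField.complexConj_eq_self_iff (K := L) (dV 1)).1 (hdV 1)⟩ : Fp L)) (mul_ne_zero (ht 0) (ht 1))))⁻¹)))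
              (lineW_ne_zero L (TW (Fp L) (-(a * (Units.mk0 ((⟨dV 0, (IsCMField.complexConj_eq_self_iff (K := L) (dV 0)).1 (hdV 0)⟩ : Fp L) * (⟨dV 1, (IsCMField.complexConj_eq_self_iff (K := L) (dV 1)).1 (hdV 1)⟩ : Fp L)) (mul_ne_zero (ht 0) (ht 1))))⁻¹)) (isUnit_det_TW (Fp L) (-(a * (Units.mk0 ((⟨dV 0, (IsCMField.complexConj_eq_self_iff (K := L) (dV 0)).1 (hdV 0)⟩ : Fp L) * (⟨dV 1, (IsCMField.complexConj_eq_self_iff (K := L) (dV 1)).1 (hdV 1)⟩ : Fp L)) (mul_ne_zero (ht 0) (ht 1))))⁻¹))) (toHeckeCharacter L (IdeleClassGroup.galConj (IsCMField.complexConj L) lam)) (borelPlaceMeasure L)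
              (cmFinLocalFamily L (Equiv.prodUnique (Fin 2) (Fin 1)) dV hdV hdV0 (lineW L (TW (Fp L) (-(a * (Units.mk0 ((⟨dV 0, (IsCMField.complexConj_eq_self_iff (K := L) (dV 0)).1 (hdV 0)⟩ : Fp L) * (⟨dV 1, (IsCMField.complexConj_eq_self_iff (K := L) (dV 1)).1 (hdV 1)⟩ : Fp L)) (mul_ne_zero (ht 0) (ht 1))))⁻¹))) (complexConj_lineW L (TW (Fp L) (-(a * (Units.mk0 ((⟨dV 0, (IsCMField.complexConj_eq_self_iff (K := L) (dV 0)).1 (hdV 0)⟩ : Fp L) * (⟨dV 1, (IsCMField.complexConj_eq_self_iff (K := L) (dV 1)).1 (hdV 1)⟩ : Fp L)) (mul_ne_zero (ht 0) (ht 1))))⁻¹)))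
                (lineW_ne_zero L (TW (Fp L) (-(a * (Units.mk0 ((⟨dV 0, (IsCMField.complexConj_eq_self_iff (K := L) (dV 0)).1 (hdV 0)⟩ : Fp L) * (⟨dV 1, (IsCMField.complexConj_eq_self_iff (K := L) (dV 1)).1 (hdV 1)⟩ : Fp L)) (mul_ne_zero (ht 0) (ht 1))))⁻¹)) (isUnit_det_TW (Fp L) (-(a * (Units.mk0 ((⟨dV 0, (IsCMField.complexConj_eq_self_iff (K := L) (dV 0)).1 (hdV 0)⟩ : Fp L) * (⟨dV 1, (IsCMField.complexConj_eq_self_iff (K := L) (dV 1)).1 (hdV 1)⟩ : Fp L)) (mul_ne_zero (ht 0) (ht 1))))⁻¹))) (toHeckeCharacter L (IdeleClassGroup.galConj (IsCMField.complexConj L) lam)) ((isOscillatorChar_toHeckeCharacter_iff _).mpr hlam.galConj) (borelPlaceMeasure L)))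
            (isSymm_TW (Fp L) (-(a * (Units.mk0 ((⟨dV 0, (IsCMField.complexConj_eq_self_iff (K := L) (dV 0)).1 (hdV 0)⟩ : Fp L) * (⟨dV 1, (IsCMField.complexConj_eq_self_iff (K := L) (dV 1)).1 (hdV 1)⟩ : Fp L)) (mul_ne_zero (ht 0) (ht 1))))⁻¹)) (JW_eq (Fp L) L (-(a * (Units.mk0 ((⟨dV 0, (IsCMField.complexConj_eq_self_iff (K := L) (dV 0)).1 (hdV 0)⟩ : Fp L) * (⟨dV 1, (IsCMField.complexConj_eq_self_iff (K := L) (dV 1)).1 (hdV 1)⟩ : Fp L)) (mul_ne_zero (ht 0) (ht 1))))⁻¹)))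
    (Literature.NumberTheory.GelbartRogawski1991.UnitaryDualPair.LocalSplitting.congrW_undoubledSplittings_cmFinLocalFamily_s L
      (Equiv.prodUnique (Fin 2) (Fin 1)) dV hdV hdV0 _ _ _ (toHeckeCharacter L (IdeleClassGroup.galConj (IsCMField.complexConj L) lam)) ((isOscillatorChar_toHeckeCharacter_iff _).mpr hlam.galConj)
      (realDiagonal_lineW L (TW (Fp L) (-(a * (Units.mk0 ((⟨dV 0, (IsCMField.complexConj_eq_self_iff (K := L) (dV 0)).1 (hdV 0)⟩ : Fp L) * (⟨dV 1, (IsCMField.complexConj_eq_self_iff (K := L) (dV 1)).1 (hdV 1)⟩ : Fp L)) (mul_ne_zero (ht 0) (ht 1))))⁻¹)))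
      (diagonal_lineW L (TW (Fp L) (-(a * (Units.mk0 ((⟨dV 0, (IsCMField.complexConj_eq_self_iff (K := L) (dV 0)).1 (hdV 0)⟩ : Fp L) * (⟨dV 1, (IsCMField.complexConj_eq_self_iff (K := L) (dV 1)).1 (hdV 1)⟩ : Fp L)) (mul_ne_zero (ht 0) (ht 1))))⁻¹)) (JW_eq (Fp L) L (-(a * (Units.mk0 ((⟨dV 0, (IsCMField.complexConj_eq_self_iff (K := L) (dV 0)).1 (hdV 0)⟩ : Fp L) * (⟨dV 1, (IsCMField.complexConj_eq_self_iff (K := L) (dV 1)).1 (hdV 1)⟩ : Fp L)) (mul_ne_zero (ht 0) (ht 1))))⁻¹))) (isSymm_TW (Fp L) (-(a * (Units.mk0 ((⟨dV 0, (IsCMField.complexConj_eq_self_iff (K := L) (dV 0)).1 (hdV 0)⟩ : Fp L) * (⟨dV 1, (IsCMField.complexConj_eq_self_iff (K := L) (dV 1)).1 (hdV 1)⟩ : Fp L)) (mul_ne_zero (ht 0) (ht 1))))⁻¹)) (isUnit_det_TW (Fp L) (-(a * (Units.mk0 ((⟨dV 0, (IsCMField.complexConj_eq_self_iff (K := L)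 (dV 0)).1 (hdV 0)⟩ : Fp L) * (⟨dV 1, (IsCMField.complexConj_eq_self_iff (K := L) (dV 1)).1 (hdV 1)⟩ : Fp L)) (mul_ne_zero (ht 0) (ht 1))))⁻¹)) (JW_eq (Fp L) L (-(a * (Units.mk0 ((⟨dV 0, (IsCMField.complexConj_eq_self_iff (K := L) (dV 0)).1 (hdV 0)⟩ : Fp L) * (⟨dV 1, (IsCMField.complexConj_eq_self_iff (K := L) (dV 1)).1 (hdV 1)⟩ : Fp L)) (mul_ne_zero (ht 0) (ht 1))))⁻¹)) v)
    (congrW L (Equiv.prodUnique (Fin 2) (Fin 1)) dV hdV (lineW L (TW (Fp L) a)) (complexConj_lineW L (TW (Fp L) a))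
            (realDiagonal_lineW L (TW (Fp L) a)) (diagonal_lineW L (TW (Fp L) a) (JW_eq (Fp L) L a))
            (undoubledSplittings L (Equiv.prodUnique (Fin 2) (Fin 1)) dV hdV hdV0 (lineW L (TW (Fp L) a)) (complexConj_lineW L (TW (Fp L) a))
              (lineW_ne_zero L (TW (Fp L) a) (isUnit_det_TW (Fp L) a)) (toHeckeCharacter L lam) (borelPlaceMeasure L)
              (cmFinLocalFamily L (Equiv.prodUnique (Fin 2) (Fin 1)) dV hdV hdV0 (lineW L (TW (Fp L) a)) (complexConj_lineW L (TW (Fp L) a))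
                (lineW_ne_zero L (TW (Fp L) a) (isUnit_det_TW (Fp L) a)) (toHeckeCharacter L lam) ((isOscillatorChar_toHeckeCharacter_iff lam).mpr hlam) (borelPlaceMeasure L)))
            (isSymm_TW (Fp L) a) (JW_eq (Fp L) L a))
    (Literature.NumberTheory.GelbartRogawski1991.UnitaryDualPair.LocalSplitting.congrW_undoubledSplittings_cmFinLocalFamily_s L
      (Equiv.prodUnique (Fin 2) (Fin 1)) dV hdV hdV0 _ _ _ (toHeckeCharacter L lam) ((isOscillatorChar_toHeckeCharacter_iff lam).mpr hlam)
      (realDiagonal_lineW L (TW (Fp L) a))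
      (diagonal_lineW L (TW (Fp L) a) (JW_eq (Fp L) L a)) (isSymm_TW (Fp L) a) (isUnit_det_TW (Fp L) a) (JW_eq (Fp L) L a) v)
  -- the multipliers cancel: `α₀((det k)_v) · ξ_b(localUnitScalar (det (k ⊗ 1))⁻¹) = 1`
  refine areIsomorphicRep_of_twisted_transports _
    (show Representation ℂ (UnitaryGroup.localPi L (IsCMField.complexConj L) 2 (Matrix.diagonal dV) v) _ from
        (TwistedCoinv.rep ((localCharOfCenter (Fp L) L (IsCMField.complexConj L) (JW (Fp L) L (-(a * (Units.mk0 ((⟨dV 0, (IsCMField.complexConj_eq_self_iff (K := L) (dV 0)).1 (hdV 0)⟩ : Fp L) * (⟨dV 1, (IsCMField.complexConj_eq_self_iff (K := L) (dV 1)).1 (hdV 1)⟩ : Fp L)) (mul_ne_zero (ht 0) (ht 1))))⁻¹)) (JW_apply_ne_zero (Fp L) L (-(a * (Units.mk0 ((⟨dV 0, (IsCMField.complexConj_eq_self_iff (K := L) (dV 0)).1 (hdV 0)⟩ : Fp L) * (⟨dV 1, (IsCMField.complexConj_eq_self_iff (K := L) (dV 1)).1 (hdV 1)⟩ : Fp L))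 (mul_ne_zero (ht 0) (ht 1))))⁻¹)) χ.1 v).comp
          (localPiGalConj L (IsCMField.complexConj L) 1 v (JW_eq (Fp L) L (-(a * (Units.mk0 ((⟨dV 0, (IsCMField.complexConj_eq_self_iff (K := L) (dV 0)).1 (hdV 0)⟩ : Fp L) * (⟨dV 1, (IsCMField.complexConj_eq_self_iff (K := L) (dV 1)).1 (hdV 1)⟩ : Fp L)) (mul_ne_zero (ht 0) (ht 1))))⁻¹))))
          ((congrW L (Equiv.prodUnique (Fin 2) (Fin 1)) dV hdV (lineW L (TW (Fp L) (-(a * (Units.mk0 ((⟨dV 0, (IsCMField.complexConj_eq_self_iff (K := L) (dV 0)).1 (hdV 0)⟩ : Fp L) * (⟨dV 1, (IsCMField.complexConj_eq_self_iff (K := L) (dV 1)).1 (hdV 1)⟩ : Fp L)) (mul_ne_zero (ht 0) (ht 1))))⁻¹))) (complexConj_lineW L (TW (Fp L) (-(a * (Units.mk0 ((⟨dV 0, (IsCMField.complexConj_eq_self_iff (K := L) (dV 0)).1 (hdV 0)⟩ : Fp L) * (⟨dV 1, (IsCMField.complexConj_eq_self_iff (K := L) (dV 1)).1 (hdV 1)⟩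 : Fp L)) (mul_ne_zero (ht 0) (ht 1))))⁻¹)))
            (realDiagonal_lineW L (TW (Fp L) (-(a * (Units.mk0 ((⟨dV 0, (IsCMField.complexConj_eq_self_iff (K := L) (dV 0)).1 (hdV 0)⟩ : Fp L) * (⟨dV 1, (IsCMField.complexConj_eq_self_iff (K := L) (dV 1)).1 (hdV 1)⟩ : Fp L)) (mul_ne_zero (ht 0) (ht 1))))⁻¹))) (diagonal_lineW L (TW (Fp L) (-(a * (Units.mk0 ((⟨dV 0, (IsCMField.complexConj_eq_self_iff (K := L) (dV 0)).1 (hdV 0)⟩ : Fp L) * (⟨dV 1, (IsCMField.complexConj_eq_self_iff (K := L) (dV 1)).1 (hdV 1)⟩ : Fp L)) (mul_ne_zero (ht 0) (ht 1))))⁻¹)) (JW_eq (Fp L) L (-(a * (Units.mk0 ((⟨dV 0, (IsCMField.complexConj_eq_self_iff (K := L) (dV 0)).1 (hdV 0)⟩ : Fp L) * (⟨dV 1, (IsCMField.complexConj_eq_self_iff (K := L) (dV 1)).1 (hdV 1)⟩ : Fp L)) (mul_ne_zero (ht 0) (ht 1))))⁻¹)))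
            (undoubledSplittings L (Equiv.prodUnique (Fin 2) (Fin 1)) dV hdV hdV0 (lineW L (TW (Fp L) (-(a * (Units.mk0 ((⟨dV 0, (IsCMField.complexConj_eq_self_iff (K := L) (dV 0)).1 (hdV 0)⟩ : Fp L) * (⟨dV 1, (IsCMField.complexConj_eq_self_iff (K := L) (dV 1)).1 (hdV 1)⟩ : Fp L)) (mul_ne_zero (ht 0) (ht 1))))⁻¹))) (complexConj_lineW L (TW (Fp L) (-(a * (Units.mk0 ((⟨dV 0, (IsCMField.complexConj_eq_self_iff (K := L) (dV 0)).1 (hdV 0)⟩ : Fp L) * (⟨dV 1, (IsCMField.complexConj_eq_self_iff (K := L) (dV 1)).1 (hdV 1)⟩ : Fp L)) (mul_ne_zero (ht 0) (ht 1))))⁻¹)))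
              (lineW_ne_zero L (TW (Fp L) (-(a * (Units.mk0 ((⟨dV 0, (IsCMField.complexConj_eq_self_iff (K := L) (dV 0)).1 (hdV 0)⟩ : Fp L) * (⟨dV 1, (IsCMField.complexConj_eq_self_iff (K := L) (dV 1)).1 (hdV 1)⟩ : Fp L)) (mul_ne_zero (ht 0) (ht 1))))⁻¹)) (isUnit_det_TW (Fp L) (-(a * (Units.mk0 ((⟨dV 0, (IsCMField.complexConj_eq_self_iff (K := L) (dV 0)).1 (hdV 0)⟩ : Fp L) * (⟨dV 1, (IsCMField.complexConj_eq_self_iff (K := L) (dV 1)).1 (hdV 1)⟩ : Fp L)) (mul_ne_zero (ht 0) (ht 1))))⁻¹))) (toHeckeCharacter L (IdeleClassGroup.galConj (IsCMField.complexConj L) lam)) (borelPlaceMeasure L)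
              (cmFinLocalFamily L (Equiv.prodUnique (Fin 2) (Fin 1)) dV hdV hdV0 (lineW L (TW (Fp L) (-(a * (Units.mk0 ((⟨dV 0, (IsCMField.complexConj_eq_self_iff (K := L) (dV 0)).1 (hdV 0)⟩ : Fp L) * (⟨dV 1, (IsCMField.complexConj_eq_self_iff (K := L) (dV 1)).1 (hdV 1)⟩ : Fp L)) (mul_ne_zero (ht 0) (ht 1))))⁻¹))) (complexConj_lineW L (TW (Fp L) (-(a * (Units.mk0 ((⟨dV 0, (IsCMField.complexConj_eq_self_iff (K := L) (dV 0)).1 (hdV 0)⟩ : Fp L) * (⟨dV 1, (IsCMField.complexConj_eq_self_iff (K := L) (dV 1)).1 (hdV 1)⟩ : Fp L)) (mul_ne_zero (ht 0) (ht 1))))⁻¹)))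
                (lineW_ne_zero L (TW (Fp L) (-(a * (Units.mk0 ((⟨dV 0, (IsCMField.complexConj_eq_self_iff (K := L) (dV 0)).1 (hdV 0)⟩ : Fp L) * (⟨dV 1, (IsCMField.complexConj_eq_self_iff (K := L) (dV 1)).1 (hdV 1)⟩ : Fp L)) (mul_ne_zero (ht 0) (ht 1))))⁻¹)) (isUnit_det_TW (Fp L) (-(a * (Units.mk0 ((⟨dV 0, (IsCMField.complexConj_eq_self_iff (K := L) (dV 0)).1 (hdV 0)⟩ : Fp L) * (⟨dV 1, (IsCMField.complexConj_eq_self_iff (K := L) (dV 1)).1 (hdV 1)⟩ : Fp L)) (mul_ne_zero (ht 0) (ht 1))))⁻¹))) (toHeckeCharacter L (IdeleClassGroup.galConj (IsCMField.complexConj L) lam)) ((isOscillatorChar_toHeckeCharacter_iff _).mpr hlam.galConj) (borelPlaceMeasure L)))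
            (isSymm_TW (Fp L) (-(a * (Units.mk0 ((⟨dV 0, (IsCMField.complexConj_eq_self_iff (K := L) (dV 0)).1 (hdV 0)⟩ : Fp L) * (⟨dV 1, (IsCMField.complexConj_eq_self_iff (K := L) (dV 1)).1 (hdV 1)⟩ : Fp L)) (mul_ne_zero (ht 0) (ht 1))))⁻¹)) (JW_eq (Fp L) L (-(a * (Units.mk0 ((⟨dV 0, (IsCMField.complexConj_eq_self_iff (K := L) (dV 0)).1 (hdV 0)⟩ : Fp L) * (⟨dV 1, (IsCMField.complexConj_eq_self_iff (K := L) (dV 1)).1 (hdV 1)⟩ : Fp L)) (mul_ne_zero (ht 0) (ht 1))))⁻¹))).omegaLoc v)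
          (commute_omegaLoc_localCenter (Fp L) L (IsCMField.complexConj L) 2 (Equiv.prodUnique (Fin 2) (Fin 1)) (Matrix.diagonal dV) (JW (Fp L) L (-(a * (Units.mk0 ((⟨dV 0, (IsCMField.complexConj_eq_self_iff (K := L) (dV 0)).1 (hdV 0)⟩ : Fp L) * (⟨dV 1, (IsCMField.complexConj_eq_self_iff (K := L) (dV 1)).1 (hdV 1)⟩ : Fp L)) (mul_ne_zero (ht 0) (ht 1))))⁻¹))
            (complexConj_imagUnit L) (imagUnit_ne_zero L) (imagUnit_mul_self L) (realDiagonal_isSymm L dV hdV) (isSymm_TW (Fp L) (-(a * (Units.mk0 ((⟨dV 0, (IsCMField.complexConj_eq_self_iff (K := L) (dV 0)).1 (hdV 0)⟩ : Fp L) * (⟨dV 1, (IsCMField.complexConj_eq_self_iff (K := L) (dV 1)).1 (hdV 1)⟩ : Fp L)) (mul_ne_zero (ht 0) (ht 1))))⁻¹))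
            (realDiagonal_map L dV hdV).symm (JW_eq (Fp L) L (-(a * (Units.mk0 ((⟨dV 0, (IsCMField.complexConj_eq_self_iff (K := L) (dV 0)).1 (hdV 0)⟩ : Fp L) * (⟨dV 1, (IsCMField.complexConj_eq_self_iff (K := L) (dV 1)).1 (hdV 1)⟩ : Fp L)) (mul_ne_zero (ht 0) (ht 1))))⁻¹)) (JW_apply_ne_zero (Fp L) L (-(a * (Units.mk0 ((⟨dV 0, (IsCMField.complexConj_eq_self_iff (K := L) (dV 0)).1 (hdV 0)⟩ : Fp L) * (⟨dV 1, (IsCMField.complexConj_eq_self_iff (K := L) (dV 1)).1 (hdV 1)⟩ : Fp L)) (mul_ne_zero (ht 0) (ht 1))))⁻¹))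
            (congrW L (Equiv.prodUnique (Fin 2) (Fin 1)) dV hdV (lineW L (TW (Fp L) (-(a * (Units.mk0 ((⟨dV 0, (IsCMField.complexConj_eq_self_iff (K := L) (dV 0)).1 (hdV 0)⟩ : Fp L) * (⟨dV 1, (IsCMField.complexConj_eq_self_iff (K := L) (dV 1)).1 (hdV 1)⟩ : Fp L)) (mul_ne_zero (ht 0) (ht 1))))⁻¹))) (complexConj_lineW L (TW (Fp L) (-(a * (Units.mk0 ((⟨dV 0, (IsCMField.complexConj_eq_self_iff (K := L) (dV 0)).1 (hdV 0)⟩ : Fp L) * (⟨dV 1, (IsCMField.complexConj_eq_self_iff (K := L) (dV 1)).1 (hdV 1)⟩ : Fp L)) (mul_ne_zero (ht 0) (ht 1))))⁻¹)))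
            (realDiagonal_lineW L (TW (Fp L) (-(a * (Units.mk0 ((⟨dV 0, (IsCMField.complexConj_eq_self_iff (K := L) (dV 0)).1 (hdV 0)⟩ : Fp L) * (⟨dV 1, (IsCMField.complexConj_eq_self_iff (K := L) (dV 1)).1 (hdV 1)⟩ : Fp L)) (mul_ne_zero (ht 0) (ht 1))))⁻¹))) (diagonal_lineW L (TW (Fp L) (-(a * (Units.mk0 ((⟨dV 0, (IsCMField.complexConj_eq_self_iff (K := L) (dV 0)).1 (hdV 0)⟩ : Fp L) * (⟨dV 1, (IsCMField.complexConj_eq_self_iff (K := L) (dV 1)).1 (hdV 1)⟩ : Fp L)) (mul_ne_zero (ht 0) (ht 1))))⁻¹)) (JW_eq (Fp L) L (-(a * (Units.mk0 ((⟨dV 0, (IsCMField.complexConj_eq_self_iff (K := L) (dV 0)).1 (hdV 0)⟩ : Fp L) * (⟨dV 1, (IsCMField.complexConj_eq_self_iff (K := L) (dV 1)).1 (hdV 1)⟩ : Fp L)) (mul_ne_zero (ht 0) (ht 1))))⁻¹)))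
            (undoubledSplittings L (Equiv.prodUnique (Fin 2) (Fin 1)) dV hdV hdV0 (lineW L (TW (Fp L) (-(a * (Units.mk0 ((⟨dV 0, (IsCMField.complexConj_eq_self_iff (K := L) (dV 0)).1 (hdV 0)⟩ : Fp L) * (⟨dV 1, (IsCMField.complexConj_eq_self_iff (K := L) (dV 1)).1 (hdV 1)⟩ : Fp L)) (mul_ne_zero (ht 0) (ht 1))))⁻¹))) (complexConj_lineW L (TW (Fp L) (-(a * (Units.mk0 ((⟨dV 0, (IsCMField.complexConj_eq_self_iff (K := L) (dV 0)).1 (hdV 0)⟩ : Fp L) * (⟨dV 1, (IsCMField.complexConj_eq_self_iff (K := L) (dV 1)).1 (hdV 1)⟩ : Fp L)) (mul_ne_zero (ht 0) (ht 1))))⁻¹)))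
              (lineW_ne_zero L (TW (Fp L) (-(a * (Units.mk0 ((⟨dV 0, (IsCMField.complexConj_eq_self_iff (K := L) (dV 0)).1 (hdV 0)⟩ : Fp L) * (⟨dV 1, (IsCMField.complexConj_eq_self_iff (K := L) (dV 1)).1 (hdV 1)⟩ : Fp L)) (mul_ne_zero (ht 0) (ht 1))))⁻¹)) (isUnit_det_TW (Fp L) (-(a * (Units.mk0 ((⟨dV 0, (IsCMField.complexConj_eq_self_iff (K := L) (dV 0)).1 (hdV 0)⟩ : Fp L) * (⟨dV 1, (IsCMField.complexConj_eq_self_iff (K := L) (dV 1)).1 (hdV 1)⟩ : Fp L)) (mul_ne_zero (ht 0) (ht 1))))⁻¹))) (toHeckeCharacter L (IdeleClassGroup.galConj (IsCMField.complexConj L) lam)) (borelPlaceMeasure L)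
              (cmFinLocalFamily L (Equiv.prodUnique (Fin 2) (Fin 1)) dV hdV hdV0 (lineW L (TW (Fp L) (-(a * (Units.mk0 ((⟨dV 0, (IsCMField.complexConj_eq_self_iff (K := L) (dV 0)).1 (hdV 0)⟩ : Fp L) * (⟨dV 1, (IsCMField.complexConj_eq_self_iff (K := L) (dV 1)).1 (hdV 1)⟩ : Fp L)) (mul_ne_zero (ht 0) (ht 1))))⁻¹))) (complexConj_lineW L (TW (Fp L) (-(a * (Units.mk0 ((⟨dV 0, (IsCMField.complexConj_eq_self_iff (K := L) (dV 0)).1 (hdV 0)⟩ : Fp L) * (⟨dV 1, (IsCMField.complexConj_eq_self_iff (K := L) (dV 1)).1 (hdV 1)⟩ : Fp L)) (mul_ne_zero (ht 0) (ht 1))))⁻¹)))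
                (lineW_ne_zero L (TW (Fp L) (-(a * (Units.mk0 ((⟨dV 0, (IsCMField.complexConj_eq_self_iff (K := L) (dV 0)).1 (hdV 0)⟩ : Fp L) * (⟨dV 1, (IsCMField.complexConj_eq_self_iff (K := L) (dV 1)).1 (hdV 1)⟩ : Fp L)) (mul_ne_zero (ht 0) (ht 1))))⁻¹)) (isUnit_det_TW (Fp L) (-(a * (Units.mk0 ((⟨dV 0, (IsCMField.complexConj_eq_self_iff (K := L) (dV 0)).1 (hdV 0)⟩ : Fp L) * (⟨dV 1, (IsCMField.complexConj_eq_self_iff (K := L) (dV 1)).1 (hdV 1)⟩ : Fp L)) (mul_ne_zero (ht 0) (ht 1))))⁻¹))) (toHeckeCharacter L (IdeleClassGroup.galConj (IsCMField.complexConj L) lam)) ((isOscillatorChar_toHeckeCharacter_iff _).mpr hlam.galConj) (borelPlaceMeasure L)))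
            (isSymm_TW (Fp L) (-(a * (Units.mk0 ((⟨dV 0, (IsCMField.complexConj_eq_self_iff (K := L) (dV 0)).1 (hdV 0)⟩ : Fp L) * (⟨dV 1, (IsCMField.complexConj_eq_self_iff (K := L) (dV 1)).1 (hdV 1)⟩ : Fp L)) (mul_ne_zero (ht 0) (ht 1))))⁻¹)) (JW_eq (Fp L) L (-(a * (Units.mk0 ((⟨dV 0, (IsCMField.complexConj_eq_self_iff (K := L) (dV 0)).1 (hdV 0)⟩ : Fp L) * (⟨dV 1, (IsCMField.complexConj_eq_self_iff (K := L) (dV 1)).1 (hdV 1)⟩ : Fp L)) (mul_ne_zero (ht 0) (ht 1))))⁻¹))) v)).comp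
          (UnitaryGroup.localLineInl L (IsCMField.complexConj L) 2 (Equiv.prodUnique (Fin 2) (Fin 1)) (Matrix.diagonal dV) (JW (Fp L) L (-(a * (Units.mk0 ((⟨dV 0, (IsCMField.complexConj_eq_self_iff (K := L) (dV 0)).1 (hdV 0)⟩ : Fp L) * (⟨dV 1, (IsCMField.complexConj_eq_self_iff (K := L) (dV 1)).1 (hdV 1)⟩ : Fp L)) (mul_ne_zero (ht 0) (ht 1))))⁻¹)) v))
    _ _ _ hT hE fun k => ?_
  have e8 := det_localPiEquiv_localLineInl (Fp L) L (IsCMField.complexConj L) 2 (Equiv.prodUnique (Fin 2) (Fin 1)) (Matrix.diagonal dV) (JW (Fp L) L (a * (Units.mk0 ((⟨dV 0, (IsCMField.complexConj_eq_self_iff (K := L) (dV 0)).1 (hdV 0)⟩ : Fp L) * (⟨dV 1, (IsCMField.complexConj_eq_self_iff (K := L) (dV 1)).1 (hdV 1)⟩ : Fp L)) (mul_ne_zero (ht 0) (ht 1))))⁻¹) v k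
  have hzb := det_mul_conjLocal_det L (IsCMField.complexConj L)
    (reindex_kronecker_eq_gram_map (Fp L) L (Equiv.prodUnique (Fin 2) (Fin 1)) (realDiagonal_map L dV hdV).symm (JW_eq (Fp L) L (a * (Units.mk0 ((⟨dV 0, (IsCMField.complexConj_eq_self_iff (K := L) (dV 0)).1 (hdV 0)⟩ : Fp L) * (⟨dV 1, (IsCMField.complexConj_eq_self_iff (K := L) (dV 1)).1 (hdV 1)⟩ : Fp L)) (mul_ne_zero (ht 0) (ht 1))))⁻¹)) v hTd
    (UnitaryGroup.localLineInl L (IsCMField.complexConj L) 2 (Equiv.prodUnique (Fin 2) (Fin 1)) (Matrix.diagonal dV) (JW (Fp L) L (a * (Units.mk0 ((⟨dV 0, (IsCMField.complexConj_eq_self_iff (K := L) (dV 0)).1 (hdV 0)⟩ : Fp L) * (⟨dV 1, (IsCMField.complexConj_eq_self_iff (K := L) (dV 1)).1 (hdV 1)⟩ : Fp L)) (mul_ne_zero (ht 0) (ht 1))))⁻¹) v k)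
  have hzs : ((Matrix.GeneralLinearGroup.det ((localPiEquiv L (IsCMField.complexConj L) 2 (Matrix.diagonal dV) v k :
        «local» L (IsCMField.complexConj L) 2 (Matrix.diagonal dV) v) : GL (Fin 2) (LocalRing L v)) : (LocalRing L v)ˣ) : LocalRing L v) *
      conjLocal L (IsCMField.complexConj L) v (Matrix.GeneralLinearGroup.det ((localPiEquiv L (IsCMField.complexConj L) 2 (Matrix.diagonal dV) v k :
        «local» L (IsCMField.complexConj L) 2 (Matrix.diagonal dV) v) : GL (Fin 2) (LocalRing L v))) = 1 := by
    rw [← e8]; exact hzb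
  rw [localUnitScalar_congr L (IsCMField.complexConj L) (JW (Fp L) L (-(a * (Units.mk0 ((⟨dV 0, (IsCMField.complexConj_eq_self_iff (K := L) (dV 0)).1 (hdV 0)⟩ : Fp L) * (⟨dV 1, (IsCMField.complexConj_eq_self_iff (K := L) (dV 1)).1 (hdV 1)⟩ : Fp L)) (mul_ne_zero (ht 0) (ht 1))))⁻¹)) v (congrArg Inv.inv e8) _
      (norm_one_inv L (IsCMField.complexConj L) v (complexConj_imagUnit L) (imagUnit_ne_zero L) _ hzs),
    ← Units.val_mul, hα₀,
    apply_finitePart_adelicDet_inclPlace_mul_localCharOfCenter_inv (Fp L) L (IsCMField.complexConj L) 2 (Matrix.diagonal dV)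
      (JW (Fp L) L (-(a * (Units.mk0 ((⟨dV 0, (IsCMField.complexConj_eq_self_iff (K := L) (dV 0)).1 (hdV 0)⟩ : Fp L) * (⟨dV 1, (IsCMField.complexConj_eq_self_iff (K := L) (dV 1)).1 (hdV 1)⟩ : Fp L)) (mul_ne_zero (ht 0) (ht 1))))⁻¹)) hJdet (JW_apply_ne_zero (Fp L) L (-(a * (Units.mk0 ((⟨dV 0, (IsCMField.complexConj_eq_self_iff (K := L) (dV 0)).1 (hdV 0)⟩ : Fp L) * (⟨dV 1, (IsCMField.complexConj_eq_self_iff (K := L) (dV 1)).1 (hdV 1)⟩ : Fp L)) (mul_ne_zero (ht 0) (ht 1))))⁻¹)) χ.1 v k hzs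
      (norm_one_inv L (IsCMField.complexConj L) v (complexConj_imagUnit L) (imagUnit_ne_zero L) _ hzs),
    Units.val_one]

end Core

/-! ## §2 THE LETTER -/

set_option synthInstance.maxHeartbeats 400000 in
set_option maxHeartbeats 8000000 in
/-- **[Liu2021, App. D, Lemma D.1 (4)], «IF» DIRECTION, SECOND ALTERNATIVE, ON THE TWO MEMBERS `(λ, a, χ)`, `(λᶜχ̌, a′, χ)` OF THE RANK-2 CM
θ-PACKAGE FAMILY AT THE NON-SPLIT FINITE PLACES — PROVED IN-HOUSE** (`LemD1RankTwoCMLetters.LemD1_4IfAsPrintedNonsplitCM₂`, the P5 ED. 7 stub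
`stub_letter_lemD14_if_nonsplit`; in print the rank-one theta dichotomy [HarrisKudlaSweet1996, Thm. 6.1]): ★ (P2) `lemD1_4IfAsPrintedNonsplitCM₂_of_core`
at the core link §1. [cite: Liu2021, App. D Lemma D.1 (4) (p. 126, l. 5235), proof l. 5249–5262] [cite: HarrisKudlaSweet1996, Thm. 6.1]
[cite: GelbartRogawski1991, §3.1 Remark p. 457 L4–13] [cite: MoeglinVignerasWaldspurger1987, Chap. 3 I.1–I.3, IV] -/
theorem lemD1_4IfAsPrintedNonsplitCM₂_holds : LemD1_4IfAsPrintedNonsplitCM₂ :=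
  lemD1_4IfAsPrintedNonsplitCM₂_of_core fun L _ _ _ dV hdV hdV0 lam hlam χ lam' hlam' hcc hH a v hns =>
    core_link_iv L dV hdV hdV0 lam hlam χ lam' hlam' hcc hH a v hns (realEntry_ne_zero L dV hdV hdV0)

end Summit.HodgeConjecture.HodgeConjecture.Cruxes.HLiu418.F0P5LemD14IfNonsplitLetter

end
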